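import Mathlib.Analysis.InnerProductSpace.PiL2
import Mathlib.Analysis.SpecialFunctions.Complex.Arg
import Mathlib.Data.Finset.Sort
import Mathlib.Data.Fintype.Pigeonhole
import Literature.Geometry.DiscreteGeometry.SphericalCodeContactGraph
import Summits.Ventures.Crystal3D.Theorems.StickyWulffConstantNoReconstructionGainConeBand
import HarnessLib

/-!
# The `45°` cap along an arbitrary axis: at most four contacts; the thin band: at most six

HONEST FRAMING. Part of the venture `Summits/Ventures/Crystal3D` (cell `crystal3d-full`), helper
lemmas `--supports` the crux `NoReconstructionGain` (stmt-Ventures-19144, route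
`route-Ventures-StickyWulffConstant`): the local counts behind the steep-or-flat layer bound for
the CUBE facet `(100)` (layer spacing `1/√2`, square layers).  Unit vectors of `ℝ³` with pairwise
inner products `≤ 1/2` (contact directions of one ball), an arbitrary unit axis `e`:

* `card_thin_band_le_six_axis` — at most six in the band `|⟪u, e⟫| ≤ 1/5` (transport of
  `card_thin_band_le_six` along an orthonormal frame with third vector `e`).
* `no_five_in_cap45`, `card_cap45_le_four` — at most FOUR with `⟪u, e⟫ ≤ −√2/2` (polar angle
  `≤ 45°` from `−e`): the horizontal parts are pairwise non-acute (`⟪ū, ū'⟫ = ⟪u,u'⟫ − zz' ≤ 0`)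
  and five pairwise non-acute directions do not fit around a circle (`planar_nonacute_le_four`).
* `four_sorted_angles_cross` — four such planar directions have consecutive sorted arguments
  differing by EXACTLY `π/2` (used for the rigidity of the square in `…CubeCross.lean`).
* Mirror version for the upper cap (`⟪u, e⟫ ≥ √2/2`).

WHAT THIS IS NOT: nothing about packings or crystallization by itself; rung F-C1 not moved.
-/

noncomputable section

namespace Summit.Ventures.Crystal3D.Theorems

open Finset Real
open Literature.Geometry.DiscreteGeometry (exists_orthonormalBasis_third_eq_unit)
open scoped InnerProductSpace

/-! ## Planar vectors pairwise non-acute: at most four, and four form a cross -/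

/-- Sorted angles `−π < t₀ < ⋯ < t_{n}` (here `n + 1 = 5`) with pairwise `cos (tᵢ − tⱼ) ≤ 0` do not
exist: consecutive gaps and the wrap-around gap would each be `≥ π/2`, summing to more than `2π`. -/
theorem five_sorted_angles_false (t : Fin 5 → ℝ) (hmono : StrictMono t)
    (hlo : -π < t 0) (hhi : t 4 ≤ π)
    (hC : ∀ i j, i ≠ j → cos (t i - t j) ≤ 0) : False := by
  have hgap : ∀ i j : Fin 5, i < j → π / 2 ≤ t j - t i := by
    intro i j hij
    have hpos : 0 < t j - t i := sub_pos.2 (hmono hij)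
    by_contra h
    have h1 : 0 < cos (t j - t i) :=
      Real.cos_pos_of_mem_Ioo ⟨by linarith [Real.pi_pos], not_le.1 h⟩
    have h2 := hC j i (ne_of_gt hij)
    linarith
  have h01 := hgap 0 1 (by decide)
  have h12 := hgap 1 2 (by decide)
  have h23 := hgap 2 3 (by decide)
  have h34 := hgap 3 4 (by decide)
  linarith [Real.pi_pos]

/-- Four sorted angles `−π < t₀ < t₁ < t₂ < t₃ ≤ π` with pairwise `cos (tᵢ − tⱼ) ≤ 0` are an exact
cross: `t_{k+1} = t_k + π/2`. -/
theorem four_sorted_angles_cross (t : Fin 4 → ℝ) (hmono : StrictMono t)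
    (hlo : -π < t 0) (hhi : t 3 ≤ π)
    (hC : ∀ i j, i ≠ j → cos (t i - t j) ≤ 0) :
    t 1 = t 0 + π / 2 ∧ t 2 = t 1 + π / 2 ∧ t 3 = t 2 + π / 2 := by
  have hgap : ∀ i j : Fin 4, i < j → π / 2 ≤ t j - t i := by
    intro i j hij
    have hpos : 0 < t j - t i := sub_pos.2 (hmono hij)
    by_contra h
    have h1 : 0 < cos (t j - t i) :=
      Real.cos_pos_of_mem_Ioo ⟨by linarith [Real.pi_pos], not_le.1 h⟩
    have h2 := hC j i (ne_of_gt hij)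
    linarith
  have h01 := hgap 0 1 (by decide)
  have h12 := hgap 1 2 (by decide)
  have h23 := hgap 2 3 (by decide)
  -- the wrap-around gap: `t 3 - t 0 ≤ 3π/2`
  have hwrap : t 3 - t 0 ≤ 3 * π / 2 := by
    by_contra h
    have h := not_le.1 h
    have hy0 : -(π / 2) < 2 * π - (t 3 - t 0) := by linarith
    have hy1 : 2 * π - (t 3 - t 0) < π / 2 := by linarith
    have h1 : 0 < cos (2 * π - (t 3 - t 0)) := Real.cos_pos_of_mem_Ioo ⟨hy0, hy1⟩
    rw [Real.cos_two_pi_sub] at h1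
    have h2 := hC 3 0 (by decide)
    linarith
  refine ⟨by linarith, by linarith, by linarith⟩

/-- **Planar non-acute directions.** For nonzero complex numbers `w₀, …, w_{n−1}` with pairwise
`Re (wᵢ · conj wⱼ) ≤ 0` (pairwise angles `≥ 90°`): `n ≤ 4`. -/
theorem planar_nonacute_le_four {n : ℕ} (w : Fin n → ℂ) (hw : ∀ k, w k ≠ 0)
    (hna : ∀ i j, i ≠ j → (w i).re * (w j).re + (w i).im * (w j).im ≤ 0) : n ≤ 4 := by
  by_contra hn
  have hn : 5 ≤ n := by omega
  -- restrict to the first five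
  set v : Fin 5 → ℂ := fun k => w (Fin.castLE hn k) with hv
  set ρ : Fin 5 → ℝ := fun k => ‖v k‖ with hρdef
  set θ : Fin 5 → ℝ := fun k => Complex.arg (v k) with hθdef
  have hre : ∀ k, (v k).re = ρ k * cos (θ k) := fun k => (Complex.norm_mul_cos_arg (v k)).symm
  have him : ∀ k, (v k).im = ρ k * sin (θ k) := fun k => (Complex.norm_mul_sin_arg (v k)).symm
  have hρ0 : ∀ k, 0 < ρ k := fun k => norm_pos_iff.2 (hw _)
  have hC : ∀ i j, i ≠ j → cos (θ i - θ j) ≤ 0 := by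
    intro i j hij
    have h := hna (Fin.castLE hn i) (Fin.castLE hn j)
      (fun h => hij (Fin.castLE_injective hn h))
    change (v i).re * (v j).re + (v i).im * (v j).im ≤ 0 at h
    rw [hre, hre, him, him] at h
    have e : ρ i * cos (θ i) * (ρ j * cos (θ j)) + ρ i * sin (θ i) * (ρ j * sin (θ j)) =
        ρ i * ρ j * cos (θ i - θ j) := by rw [cos_sub]; ring
    rw [e] at h
    by_contra hc
    have : 0 < ρ i * ρ j * cos (θ i - θ j) := mul_pos (mul_pos (hρ0 i) (hρ0 j)) (not_le.1 hc)
    linarith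
  have hθinj : Function.Injective θ := by
    intro i j hij
    by_contra hne
    have h := hC i j hne
    rw [hij, sub_self, Real.cos_zero] at h
    linarith
  have hAcard : (Finset.univ.image θ).card = 5 := by
    rw [Finset.card_image_of_injective _ hθinj, Finset.card_univ, Fintype.card_fin]
  let emb := (Finset.univ.image θ).orderEmbOfFin hAcard
  have hmem : ∀ k, ∃ i, θ i = emb k := by
    intro k
    have := (Finset.univ.image θ).orderEmbOfFin_mem hAcard k
    rw [Finset.mem_image] at this
    obtain ⟨i, -, hi⟩ := this
    exact ⟨i, hi⟩
  choose π' hπ' using hmem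
  refine five_sorted_angles_false (fun k => emb k) emb.strictMono ?_ ?_ ?_
  · show -π < emb 0
    rw [← hπ' 0]; exact Complex.neg_pi_lt_arg _
  · show emb 4 ≤ π
    rw [← hπ' 4]; exact Complex.arg_le_pi _
  · intro i j hij
    have hne : π' i ≠ π' j := by
      intro h; apply hij; apply emb.injective; rw [← hπ' i, ← hπ' j, h]
    rw [← hπ' i, ← hπ' j]
    exact hC _ _ hne

/-! ## Transport of the band lemma to an arbitrary axis -/

open Literature.Geometry.DiscreteGeometry (inner_eq_sum_three) in
/-- **At most six in a thin band about any axis.** For a unit vector `e`, a finite set of unit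
vectors with `|⟪u, e⟫| ≤ 1/5` and pairwise inner products `≤ 1/2` has at most six elements. -/
theorem card_thin_band_le_six_axis (e : EuclideanSpace ℝ (Fin 3)) (he : ‖e‖ = 1)
    {F : Finset (EuclideanSpace ℝ (Fin 3))} (hn : ∀ u ∈ F, ‖u‖ = 1)
    (hz : ∀ u ∈ F, |⟪u, e⟫_ℝ| ≤ 1 / 5)
    (hsep : ∀ u ∈ F, ∀ w ∈ F, u ≠ w → ⟪u, w⟫_ℝ ≤ 1 / 2) : F.card ≤ 6 := by
  classical
  obtain ⟨b, hb⟩ := exists_orthonormalBasis_third_eq_unit he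
  have hinj : Set.InjOn (fun u => (b.repr u : EuclideanSpace ℝ (Fin 3))) ↑F :=
    fun u _ w _ h => b.repr.injective h
  rw [← Finset.card_image_of_injOn hinj]
  refine card_thin_band_le_six ?_ ?_ ?_
  · intro u hu
    obtain ⟨w, hw, rfl⟩ := Finset.mem_image.1 hu
    rw [LinearIsometryEquiv.norm_map]; exact hn w hw
  · intro u hu
    obtain ⟨w, hw, rfl⟩ := Finset.mem_image.1 hu
    rw [show (b.repr w : EuclideanSpace ℝ (Fin 3)) 2 = ⟪b 2, w⟫_ℝ from b.repr_apply_apply w 2, hb,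
      real_inner_comm]
    exact hz w hw
  · intro u hu w hw huw
    obtain ⟨u', hu', rfl⟩ := Finset.mem_image.1 hu
    obtain ⟨w', hw', rfl⟩ := Finset.mem_image.1 hw
    rw [LinearIsometryEquiv.inner_map_map]
    exact hsep u' hu' w' hw' fun h => huw (by rw [h])

/-! ## The `45°` cap: at most four, and four are a rigid square -/

open Literature.Geometry.DiscreteGeometry (inner_eq_sum_three) in
/-- **No five in the `45°` cap.** Five unit vectors of `ℝ³` with `⟪uₖ, e⟫ ≤ −√2/2` (`e` a unit
vector) and pairwise inner products `≤ 1/2` do not exist: their components orthogonal to `e` are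
pairwise non-acute (`⟪ū, ū'⟫ = ⟪u, u'⟫ − z z' ≤ 1/2 − 1/2`) and non-zero. -/
theorem no_five_in_cap45 (e : EuclideanSpace ℝ (Fin 3)) (he : ‖e‖ = 1)
    (u : Fin 5 → EuclideanSpace ℝ (Fin 3)) (hn : ∀ k, ‖u k‖ = 1)
    (hz : ∀ k, ⟪u k, e⟫_ℝ ≤ -(Real.sqrt 2 / 2))
    (hsep : ∀ i j, i ≠ j → ⟪u i, u j⟫_ℝ ≤ 1 / 2) : False := by
  obtain ⟨b, hb⟩ := exists_orthonormalBasis_third_eq_unit he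
  have hc2 : (Real.sqrt 2 / 2) ^ 2 = 1 / 2 := by
    rw [div_pow, Real.sq_sqrt (by norm_num)]; norm_num
  have hcpos : 0 < Real.sqrt 2 / 2 := by positivity
  set X : Fin 5 → ℝ := fun k => ⟪b 0, u k⟫_ℝ with hXdef
  set Y : Fin 5 → ℝ := fun k => ⟪b 1, u k⟫_ℝ with hYdef
  set Z : Fin 5 → ℝ := fun k => ⟪b 2, u k⟫_ℝ with hZdef
  have hZ : ∀ k, Z k ≤ -(Real.sqrt 2 / 2) := fun k => by
    simp only [hZdef, hb]; rw [real_inner_comm]; exact hz k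
  have hXYZ : ∀ k, X k ^ 2 + Y k ^ 2 + Z k ^ 2 = 1 := by
    intro k
    have h1 : ⟪u k, u k⟫_ℝ = 1 := by rw [real_inner_self_eq_norm_sq, hn k]; norm_num
    rw [inner_eq_sum_three b] at h1
    simp only [hXdef, hYdef, hZdef]; linarith [h1]
  have hinner : ∀ i j, ⟪u i, u j⟫_ℝ = X i * X j + Y i * Y j + Z i * Z j := fun i j => by
    rw [inner_eq_sum_three b]
  set w : Fin 5 → ℂ := fun k => ⟨X k, Y k⟩ with hw
  have hwne : ∀ k, w k ≠ 0 := by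
    intro k h0
    have hX0 : X k = 0 := by have := congrArg Complex.re h0; simpa [hw] using this
    have hY0 : Y k = 0 := by have := congrArg Complex.im h0; simpa [hw] using this
    -- then `Z k = -1` and any other vector is too close
    obtain ⟨l, hl⟩ : ∃ l : Fin 5, l ≠ k := ⟨k + 1, by simp⟩
    have h := hsep k l (Ne.symm hl)
    rw [hinner, hX0, hY0] at h
    have hZk : Z k ^ 2 = 1 := by nlinarith [hXYZ k]
    have hZk' : Z k = -1 := by nlinarith [hZ k]
    rw [hZk'] at h
    nlinarith [hZ l, Real.sqrt_nonneg 2, hc2]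
  have hna : ∀ i j, i ≠ j → (w i).re * (w j).re + (w i).im * (w j).im ≤ 0 := by
    intro i j hij
    have h := hsep i j hij
    rw [hinner] at h
    show X i * X j + Y i * Y j ≤ 0
    nlinarith [mul_nonneg (show 0 ≤ -(Z i) - Real.sqrt 2 / 2 by linarith [hZ i])
      (show 0 ≤ -(Z j) - Real.sqrt 2 / 2 by linarith [hZ j]), hZ i, hZ j]
  have := planar_nonacute_le_four w hwne hna
  omega

/-- **At most four in the `45°` cap.** For a unit vector `e`, a finite set of unit vectors with
`⟪u, e⟫ ≤ −√2/2` and pairwise inner products `≤ 1/2` has at most four elements. -/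
theorem card_cap45_le_four (e : EuclideanSpace ℝ (Fin 3)) (he : ‖e‖ = 1)
    {F : Finset (EuclideanSpace ℝ (Fin 3))} (hn : ∀ u ∈ F, ‖u‖ = 1)
    (hz : ∀ u ∈ F, ⟪u, e⟫_ℝ ≤ -(Real.sqrt 2 / 2))
    (hsep : ∀ u ∈ F, ∀ w ∈ F, u ≠ w → ⟪u, w⟫_ℝ ≤ 1 / 2) : F.card ≤ 4 := by
  by_contra h
  obtain ⟨F', hF', hcard⟩ := Finset.exists_subset_card_eq (show 5 ≤ F.card by omega)
  set eqv := (Finset.equivFinOfCardEq hcard).symm with heqv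
  refine no_five_in_cap45 e he (fun k => ((eqv k : F') : EuclideanSpace ℝ (Fin 3)))
    (fun k => hn _ (hF' (eqv k).2)) (fun k => hz _ (hF' (eqv k).2))
    fun i j hij => hsep _ (hF' (eqv i).2) _ (hF' (eqv j).2) ?_
  exact fun h => hij (eqv.injective (Subtype.val_injective h))

/-- The mirrored cap `⟪u, e⟫ ≥ √2/2`: at most four. -/
theorem card_cap45_le_four' (e : EuclideanSpace ℝ (Fin 3)) (he : ‖e‖ = 1)
    {F : Finset (EuclideanSpace ℝ (Fin 3))} (hn : ∀ u ∈ F, ‖u‖ = 1)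
    (hz : ∀ u ∈ F, Real.sqrt 2 / 2 ≤ ⟪u, e⟫_ℝ)
    (hsep : ∀ u ∈ F, ∀ w ∈ F, u ≠ w → ⟪u, w⟫_ℝ ≤ 1 / 2) : F.card ≤ 4 := by
  refine card_cap45_le_four (-e) (by rw [norm_neg, he]) hn (fun u hu => ?_) hsep
  rw [inner_neg_right]; linarith [hz u hu]


end Summit.Ventures.Crystal3D.Theorems

end
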